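import Literature.MathematicalPhysics.QuantumFieldTheory.Balaban1983to89.Node00.WilsonActionSecondVariationL2Letters

/-!
# NODE 00 — THE FIRST VARIATION OF THE WILSON ACTION (5) IS SMALL AT SMALL PLAQUETTE FIELD: `|d∕ds A(U·e^{sX})∣₀| ≤ Σ_p ‖U(∂p) − 1‖·s_p(X)`,
# `s_p(X) = Σ_{k≤4}‖X_{b_k}‖` — the size of the CURRENT `J_{k,Z}` of [Balaban1989LargeFieldII] (1.12) at a near-flat background, with the GAUGE-INVARIANT plaquette
# (curvature) deviation as the smallness; at flat curvature (`U(∂p) = 1` for every `p`: `U ≡ 1`, pure gauges) the first variation VANISHES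

statement-level skeleton of published theorems with citation tags; proofs where landed; nothing here is a claim about the Yang–Mills mass gap

Cell `pub-ymgap`, HUMAN RULING D-0062 ∕ D-0149, WIDTH SEAT `pub-ymgap-dag-n12-w4` g2 (node N12 = [B15]; U2c lane = the VALUE-level near-flat assembly of [B16] (1.7); key K1⁷
`stmt-QuantumFields-20542`, `--kind proof --supports …`; count-neutral).  This is the factor `j` of letter (μ) of this seat's `B16Ineq17NearFlatOneSided.multiplier_letter_of_current`
(p593499): the multiplier of the constrained-critical background is the first variation through a right inverse, `λ₀ = Da(x₀) ∘ R`, and `|Da(x₀)X| ≤ j‖X‖` is what this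
file supplies at NODE 00's action.  THE FIRST-ORDER TWIN of dag-n12-w2's letter (b) `abs_deriv_deriv_wilsonAction4_expChart_sub_flat_le_local` (p587195; the SECOND variation
at `U` versus at `1`).  CONSUMED BY NAME, nothing restated: dag-n12-w2's FORMULA `deriv_wilsonAction4_expChart_zero` (p583639: `d∕ds A(U·e^{sX})∣₀ = −(1∕N)·Σ_p Re Tr(S_p·U(∂p))`,
`S_p = X′₁ + X′₂ − X′₃ − X′₄` the four transported letters of [B9] (3.2)), its `star_coe_lieSU`, `star_conj_of_star_eq_neg`, `re_trace_eq_zero_of_star_eq_neg` (p585069), Mathlib's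
`CStarRing.norm_mul_mem_unitary` ∕ `norm_mem_unitary_mul`, `MatrixNorms.abs_nReTr_le_opNorm` (B7 (20) `|Re tr M| ≤ ‖M‖`), and dag-n12-w2 g2's bond-star count
`sum_plaq_boundary_eq` (p593907: `Σ_p (g b₁ + g b₂ + g b₃ + g b₄) = 2(d−1)·Σ_b g b` — for the `ℓ¹(bonds)` form).  Tree twin in another currency (cited, not
restated): `Summits/…/T4Continuum/Support/NE3EnergySource.abs_firstVariation_le` (the NE3 spine's `Site d → Fin d → 𝕄ˣ` configurations).

PRINT.  [B9] = [Balaban1985BackgroundPropagators] p. 391 (3.7): «A^η(U′U₀) = A^η(U₀) + ⟨D^η_{U₀}A, η⁻²Im ∂U₀⟩ + ½⟨A, Δ^η(U₀)A⟩ + ⋯» — the LINEAR term is the pairing of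
the variation with `Im ∂U₀ = Im(U₀(∂p) − 1)`, which vanishes at flat curvature and is small at small field; [15] = [Balaban1985Variational] (2) p. 278: the lattice Yang–Mills
current «J = D^{η*}_U η⁻² Im ∂U»; [B16] = [Balaban1989LargeFieldII] (1.12) p. 359: «⟨δB′, H_{1,k}J_{k,Z}⟩ + ⟨δB′, H_{1,k}Δ₁H_{1,k}B′⟩ + …» — `J_{k,Z}` the current at the
background `U_{k,Z}(V_k)`, small because `|∂U_{k,Z} − 1|` is (p. 357: `|A₀|, |∇A₀| < O(1)M⁵R_kε_k` on `Z`).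

THE ESTIMATE.  `S_p` is skew-Hermitian (unitary conjugates of `𝔰𝔲(N)` letters), so `Re Tr(S_p) = 0` and `Re Tr(S_p·U(∂p)) = Re Tr(S_p·(U(∂p) − 1))`; then
`|Re Tr(M)| ≤ N‖M‖_op`, `‖S_p(U(∂p) − 1)‖ ≤ ‖S_p‖·‖U(∂p) − 1‖` and `‖S_p‖ ≤ s_p(X)` (conjugation by unitaries is isometric in the operator norm (19)).

CONTENTS (theorems only; no `def`, no `instance`, no `sorry`; axioms standard).
§1 `re_trace_mul_eq_re_trace_mul_sub_one_of_skew` (`Re Tr(SW) = Re Tr(S(W − 1))` for skew `S`), `abs_re_trace_skew_mul_le` (`|Re Tr(SW)| ≤ N·δ·s` for `‖S‖ ≤ s`,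
   `‖W − 1‖ ≤ δ`), `star_transportedSum_eq_neg` (`S_p` is skew), `norm_transportedSum_le` (`‖S_p‖ ≤ s_p(X)`).
§2 ★★ `abs_deriv_wilsonAction4_expChart_zero_le_local` (per-plaquette budgets `‖U(∂p) − 1‖ ≤ δ_p`: `|d∕ds A(U·e^{sX})∣₀| ≤ Σ_p δ_p·s_p(X)`), `abs_deriv_wilsonAction4_expChart_zero_le`
   (uniform `δ`: `≤ δ·Σ_p s_p(X)`), ★ `abs_deriv_wilsonAction4_expChart_zero_le_l1` (uniform `δ`, `ℓ¹(bonds)` form: `≤ 2(d−1)·δ·Σ_b‖X_b‖` by the bond-star count),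
   `deriv_wilsonAction4_expChart_zero_eq_zero_of_plaqHol_eq_one` (flat curvature ⇒ critical).

HONEST FRAMING: an elementary operator-norm estimate about the tree's own action functional; no gauge fixing (the hypothesis is the gauge-invariant plaquette deviation);
the right-inverse bound `ρ` and the chart curvature `M₂` of letter (μ), and the norm bookkeeping `Σ_p δ_p s_p(X) ≤ j‖X‖` in the consumer's norm (volume ∕ localisation
factors — print's `O(1)M⁶R_kε_k`), are NOT here; nothing of Bałaban's estimates beyond this explicit inequality is asserted; count-neutral; N12 NOT discharged (5∕27
unmoved); K1⁷ NOT closed; one finite 𝕋⁴ programme at fixed ε, Bałaban AS PRINTED with locators; R4 closes the conditional rung `BalabanLadder.UV` only — NOT continuum ∕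
ℝ⁴ ∕ OS ∕ mass gap ∕ Clay.

## References
* [Balaban1985BackgroundPropagators] T. Bałaban, Commun. Math. Phys. 99 (1985) 389–434: (3.2) p. 390, (3.5)–(3.7) p. 391.
* [Balaban1985Variational] T. Bałaban, Commun. Math. Phys. 102 (1985) 277–309: (2) p. 278 (the current), (5) p. 278 (the action).
* [Balaban1989LargeFieldII] T. Bałaban, Commun. Math. Phys. 122 (1989) 355–392: p. 357, (1.12) p. 359.
* [Balaban1985Averaging] T. Bałaban, Commun. Math. Phys. 98 (1985) 17–51: (19)–(20) p. 21 (operator norm, `|Re tr M| ≤ ‖M‖`).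
-/

noncomputable section

namespace Literature.MathematicalPhysics.QuantumFieldTheory.Balaban1983to89.Node00

open T4AdjointCovarianceUnitary (lieSU)
open scoped Matrix.Norms.L2Operator

/-! ## §1  Skew letters against a near-identity plaquette variable -/

section Letters

variable {N : ℕ}

/-- For a skew-Hermitian `S` (`Re Tr S = 0`) and any `W`: `Re Tr(S·W) = Re Tr(S·(W − 1))` — the linear term of (3.7) sees only `U(∂p) − 1` («Im ∂U₀»).
[cite: Balaban1985BackgroundPropagators, (3.7) p.391; Balaban1985Variational, (2) p.278] -/
theorem re_trace_mul_eq_re_trace_mul_sub_one_of_skew {S : Matrix (Fin N) (Fin N) ℂ} (hS : star S = -S) (W : Matrix (Fin N) (Fin N) ℂ) :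
    (Matrix.trace (S * W)).re = (Matrix.trace (S * (W - 1))).re := by
  rw [mul_sub, mul_one, Matrix.trace_sub, Complex.sub_re, re_trace_eq_zero_of_star_eq_neg hS, sub_zero]

variable [NeZero N]

/-- **THE LINEAR TERM PER PLAQUETTE**: for skew `S` with `‖S‖ ≤ s` and `‖W − 1‖ ≤ δ` (operator norm (19)): `|Re Tr(S·W)| ≤ δ·s·N` (B7 (20) `|Re tr M| ≤ ‖M‖` with
`tr = Tr∕N`). [cite: Balaban1985Averaging, (19)–(20) p.21; Balaban1985BackgroundPropagators, (3.7) p.391] -/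
theorem abs_re_trace_skew_mul_le {S W : Matrix (Fin N) (Fin N) ℂ} (hS : star S = -S) {s δ : ℝ} (hs : ‖S‖ ≤ s) (hW : ‖W - 1‖ ≤ δ) :
    |(Matrix.trace (S * W)).re| ≤ δ * s * (Fintype.card (Fin N) : ℝ) := by
  have hN : (0 : ℝ) < (Fintype.card (Fin N) : ℝ) := Nat.cast_pos.mpr (Fintype.card_pos (α := Fin N))
  rw [re_trace_mul_eq_re_trace_mul_sub_one_of_skew hS]
  have h := MatrixNorms.abs_nReTr_le_opNorm (S * (W - 1))
  unfold UnitaryModel.nReTr at h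
  rw [abs_div, Nat.abs_cast, div_le_iff₀ hN] at h
  refine h.trans (mul_le_mul_of_nonneg_right ?_ (Nat.cast_nonneg _))
  have s0 : 0 ≤ s := (norm_nonneg _).trans hs
  calc ‖S * (W - 1)‖ ≤ ‖S‖ * ‖W - 1‖ := norm_mul_le _ _
    _ ≤ s * δ := mul_le_mul hs hW (norm_nonneg _) s0
    _ = δ * s := mul_comm _ _

omit [NeZero N] in
/-- **THE TRANSPORTED LETTER SUM IS SKEW**: `S_p = X′₁ + X′₂ − X′₃ − X′₄`, `X′_k` unitary conjugates of the `𝔰𝔲(N)` letters ((3.2)∕(3.5)), satisfies `S_p⋆ = −S_p`.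
[cite: Balaban1985BackgroundPropagators, (3.2) p.390, (3.5) p.391] -/
theorem star_transportedSum_eq_neg (A B C : SU N) (X₁ X₂ X₃ X₄ : lieSU (Fin N)) :
    star ((A : Matrix (Fin N) (Fin N) ℂ) * (X₁ : Matrix (Fin N) (Fin N) ℂ) * star (A : Matrix (Fin N) (Fin N) ℂ)
        + (A : Matrix (Fin N) (Fin N) ℂ) * (B : Matrix (Fin N) (Fin N) ℂ) * (X₂ : Matrix (Fin N) (Fin N) ℂ) * star ((A : Matrix (Fin N) (Fin N) ℂ) * (B : Matrix (Fin N) (Fin N) ℂ))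
        + -((A : Matrix (Fin N) (Fin N) ℂ) * (B : Matrix (Fin N) (Fin N) ℂ) * (X₃ : Matrix (Fin N) (Fin N) ℂ) * star ((A : Matrix (Fin N) (Fin N) ℂ) * (B : Matrix (Fin N) (Fin N) ℂ)))
        + -((A : Matrix (Fin N) (Fin N) ℂ) * (B : Matrix (Fin N) (Fin N) ℂ) * star (C : Matrix (Fin N) (Fin N) ℂ) * (X₄ : Matrix (Fin N) (Fin N) ℂ)
            * star ((A : Matrix (Fin N) (Fin N) ℂ) * (B : Matrix (Fin N) (Fin N) ℂ) * star (C : Matrix (Fin N) (Fin N) ℂ))))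
      = -((A : Matrix (Fin N) (Fin N) ℂ) * (X₁ : Matrix (Fin N) (Fin N) ℂ) * star (A : Matrix (Fin N) (Fin N) ℂ)
        + (A : Matrix (Fin N) (Fin N) ℂ) * (B : Matrix (Fin N) (Fin N) ℂ) * (X₂ : Matrix (Fin N) (Fin N) ℂ) * star ((A : Matrix (Fin N) (Fin N) ℂ) * (B : Matrix (Fin N) (Fin N) ℂ))
        + -((A : Matrix (Fin N) (Fin N) ℂ) * (B : Matrix (Fin N) (Fin N) ℂ) * (X₃ : Matrix (Fin N) (Fin N) ℂ) * star ((A : Matrix (Fin N) (Fin N) ℂ) * (B : Matrix (Fin N) (Fin N) ℂ)))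
        + -((A : Matrix (Fin N) (Fin N) ℂ) * (B : Matrix (Fin N) (Fin N) ℂ) * star (C : Matrix (Fin N) (Fin N) ℂ) * (X₄ : Matrix (Fin N) (Fin N) ℂ)
            * star ((A : Matrix (Fin N) (Fin N) ℂ) * (B : Matrix (Fin N) (Fin N) ℂ) * star (C : Matrix (Fin N) (Fin N) ℂ)))) := by
  have h1 : star ((A : Matrix (Fin N) (Fin N) ℂ) * (X₁ : Matrix (Fin N) (Fin N) ℂ) * star (A : Matrix (Fin N) (Fin N) ℂ))
      = -((A : Matrix (Fin N) (Fin N) ℂ) * (X₁ : Matrix (Fin N) (Fin N) ℂ) * star (A : Matrix (Fin N) (Fin N) ℂ)) :=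
    star_conj_of_star_eq_neg (star_coe_lieSU X₁)
  have h2 : star ((A : Matrix (Fin N) (Fin N) ℂ) * (B : Matrix (Fin N) (Fin N) ℂ) * (X₂ : Matrix (Fin N) (Fin N) ℂ) * star ((A : Matrix (Fin N) (Fin N) ℂ) * (B : Matrix (Fin N) (Fin N) ℂ)))
      = -((A : Matrix (Fin N) (Fin N) ℂ) * (B : Matrix (Fin N) (Fin N) ℂ) * (X₂ : Matrix (Fin N) (Fin N) ℂ) * star ((A : Matrix (Fin N) (Fin N) ℂ) * (B : Matrix (Fin N) (Fin N) ℂ))) :=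
    star_conj_of_star_eq_neg (star_coe_lieSU X₂)
  have h3 : star ((A : Matrix (Fin N) (Fin N) ℂ) * (B : Matrix (Fin N) (Fin N) ℂ) * (X₃ : Matrix (Fin N) (Fin N) ℂ) * star ((A : Matrix (Fin N) (Fin N) ℂ) * (B : Matrix (Fin N) (Fin N) ℂ)))
      = -((A : Matrix (Fin N) (Fin N) ℂ) * (B : Matrix (Fin N) (Fin N) ℂ) * (X₃ : Matrix (Fin N) (Fin N) ℂ) * star ((A : Matrix (Fin N) (Fin N) ℂ) * (B : Matrix (Fin N) (Fin N) ℂ))) :=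
    star_conj_of_star_eq_neg (star_coe_lieSU X₃)
  have h4 : star ((A : Matrix (Fin N) (Fin N) ℂ) * (B : Matrix (Fin N) (Fin N) ℂ) * star (C : Matrix (Fin N) (Fin N) ℂ) * (X₄ : Matrix (Fin N) (Fin N) ℂ)
        * star ((A : Matrix (Fin N) (Fin N) ℂ) * (B : Matrix (Fin N) (Fin N) ℂ) * star (C : Matrix (Fin N) (Fin N) ℂ)))
      = -((A : Matrix (Fin N) (Fin N) ℂ) * (B : Matrix (Fin N) (Fin N) ℂ) * star (C : Matrix (Fin N) (Fin N) ℂ) * (X₄ : Matrix (Fin N) (Fin N) ℂ)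
        * star ((A : Matrix (Fin N) (Fin N) ℂ) * (B : Matrix (Fin N) (Fin N) ℂ) * star (C : Matrix (Fin N) (Fin N) ℂ))) :=
    star_conj_of_star_eq_neg (star_coe_lieSU X₄)
  rw [star_add, star_add, star_add, star_neg, star_neg, h1, h2, h3, h4]
  abel

omit [NeZero N] in
/-- **THE TRANSPORTED LETTER SUM IS BOUNDED BY THE LETTERS**: `‖S_p‖ ≤ ‖X₁‖ + ‖X₂‖ + ‖X₃‖ + ‖X₄‖` — unitary conjugation is isometric in the operator norm (19).
[cite: Balaban1985Averaging, (19)–(20) p.21; Balaban1985BackgroundPropagators, (3.2) p.390] -/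
theorem norm_transportedSum_le (A B C : SU N) (X₁ X₂ X₃ X₄ : lieSU (Fin N)) :
    ‖(A : Matrix (Fin N) (Fin N) ℂ) * (X₁ : Matrix (Fin N) (Fin N) ℂ) * star (A : Matrix (Fin N) (Fin N) ℂ)
        + (A : Matrix (Fin N) (Fin N) ℂ) * (B : Matrix (Fin N) (Fin N) ℂ) * (X₂ : Matrix (Fin N) (Fin N) ℂ) * star ((A : Matrix (Fin N) (Fin N) ℂ) * (B : Matrix (Fin N) (Fin N) ℂ))
        + -((A : Matrix (Fin N) (Fin N) ℂ) * (B : Matrix (Fin N) (Fin N) ℂ) * (X₃ : Matrix (Fin N) (Fin N) ℂ) * star ((A : Matrix (Fin N) (Fin N) ℂ) * (B : Matrix (Fin N) (Fin N) ℂ)))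
        + -((A : Matrix (Fin N) (Fin N) ℂ) * (B : Matrix (Fin N) (Fin N) ℂ) * star (C : Matrix (Fin N) (Fin N) ℂ) * (X₄ : Matrix (Fin N) (Fin N) ℂ)
            * star ((A : Matrix (Fin N) (Fin N) ℂ) * (B : Matrix (Fin N) (Fin N) ℂ) * star (C : Matrix (Fin N) (Fin N) ℂ)))‖
      ≤ ‖(X₁ : Matrix (Fin N) (Fin N) ℂ)‖ + ‖(X₂ : Matrix (Fin N) (Fin N) ℂ)‖ + ‖(X₃ : Matrix (Fin N) (Fin N) ℂ)‖ + ‖(X₄ : Matrix (Fin N) (Fin N) ℂ)‖ := by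
  have uA : (A : Matrix (Fin N) (Fin N) ℂ) ∈ unitary (Matrix (Fin N) (Fin N) ℂ) := A.2.1
  have uB : (B : Matrix (Fin N) (Fin N) ℂ) ∈ unitary (Matrix (Fin N) (Fin N) ℂ) := B.2.1
  have uC : (C : Matrix (Fin N) (Fin N) ℂ) ∈ unitary (Matrix (Fin N) (Fin N) ℂ) := C.2.1
  have uAB := mul_mem uA uB
  have uABC := mul_mem uAB (Unitary.star_mem uC)
  have e1 : ‖(A : Matrix (Fin N) (Fin N) ℂ) * (X₁ : Matrix (Fin N) (Fin N) ℂ) * star (A : Matrix (Fin N) (Fin N) ℂ)‖ = ‖(X₁ : Matrix (Fin N) (Fin N) ℂ)‖ := by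
    rw [CStarRing.norm_mul_mem_unitary _ (Unitary.star_mem uA), CStarRing.norm_mem_unitary_mul _ uA]
  have e2 : ‖(A : Matrix (Fin N) (Fin N) ℂ) * (B : Matrix (Fin N) (Fin N) ℂ) * (X₂ : Matrix (Fin N) (Fin N) ℂ) * star ((A : Matrix (Fin N) (Fin N) ℂ) * (B : Matrix (Fin N) (Fin N) ℂ))‖
      = ‖(X₂ : Matrix (Fin N) (Fin N) ℂ)‖ := by
    rw [CStarRing.norm_mul_mem_unitary _ (Unitary.star_mem uAB), CStarRing.norm_mem_unitary_mul _ uAB]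
  have e3 : ‖-((A : Matrix (Fin N) (Fin N) ℂ) * (B : Matrix (Fin N) (Fin N) ℂ) * (X₃ : Matrix (Fin N) (Fin N) ℂ) * star ((A : Matrix (Fin N) (Fin N) ℂ) * (B : Matrix (Fin N) (Fin N) ℂ)))‖
      = ‖(X₃ : Matrix (Fin N) (Fin N) ℂ)‖ := by
    rw [norm_neg, CStarRing.norm_mul_mem_unitary _ (Unitary.star_mem uAB), CStarRing.norm_mem_unitary_mul _ uAB]
  have e4 : ‖-((A : Matrix (Fin N) (Fin N) ℂ) * (B : Matrix (Fin N) (Fin N) ℂ) * star (C : Matrix (Fin N) (Fin N) ℂ) * (X₄ : Matrix (Fin N) (Fin N) ℂ)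
        * star ((A : Matrix (Fin N) (Fin N) ℂ) * (B : Matrix (Fin N) (Fin N) ℂ) * star (C : Matrix (Fin N) (Fin N) ℂ)))‖ = ‖(X₄ : Matrix (Fin N) (Fin N) ℂ)‖ := by
    rw [norm_neg, CStarRing.norm_mul_mem_unitary _ (Unitary.star_mem uABC), CStarRing.norm_mem_unitary_mul _ uABC]
  exact norm_add_le_of_le (norm_add_le_of_le (norm_add_le_of_le e1.le e2.le) e3.le) e4.le

end Letters

/-! ## §2  On the lattice: the first variation of (5) at a near-flat background -/

section Lattice

variable {P : Params} {j : ℕ} {N : ℕ} [NeZero N]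

/-- ★★ **THE FIRST VARIATION IS SMALL AT SMALL PLAQUETTE FIELD, PLAQUETTE-LOCAL FORM**: with a curvature budget `‖U(∂p) − 1‖ ≤ δ_p` per plaquette (gauge invariant; where
`X` vanishes on `∂p` the plaquette contributes `0` whatever `δ_p` is, so `δ_p := 2` is always admissible there),
`|d∕ds A(U·e^{sX})∣₀| ≤ Σ_p δ_p·(‖X_{b₁}‖ + ‖X_{b₂}‖ + ‖X_{b₃}‖ + ‖X_{b₄}‖)` — the size of the current `J_{k,Z}` of (1.12) at the background, paired with `X`.
[cite: Balaban1989LargeFieldII, (1.12) p.359, p.357; Balaban1985BackgroundPropagators, (3.7) p.391; Balaban1985Variational, (2) p.278] -/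
theorem abs_deriv_wilsonAction4_expChart_zero_le_local (U : GaugeField P j (SU N)) (X : PBond P j → lieSU (Fin N)) (δ : Plaq P j → ℝ)
    (hδ : ∀ p : Plaq P j, ‖((GaugeField.plaqHol U p : SU N) : Matrix (Fin N) (Fin N) ℂ) - 1‖ ≤ δ p) :
    |deriv (fun s : ℝ => wilsonAction4 (expChart U (s • X))) 0|
      ≤ ∑ p : Plaq P j, δ p * (‖(X ⟨p.src, p.μ⟩ : Matrix (Fin N) (Fin N) ℂ)‖ + ‖(X ⟨p.src.shift p.μ, p.ν⟩ : Matrix (Fin N) (Fin N) ℂ)‖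
        + ‖(X ⟨p.src.shift p.ν, p.μ⟩ : Matrix (Fin N) (Fin N) ℂ)‖ + ‖(X ⟨p.src, p.ν⟩ : Matrix (Fin N) (Fin N) ℂ)‖) := by
  have hN : (0 : ℝ) < (Fintype.card (Fin N) : ℝ) := Nat.cast_pos.mpr (Fintype.card_pos (α := Fin N))
  rw [deriv_wilsonAction4_expChart_zero, abs_div, abs_neg, Nat.abs_cast, div_le_iff₀ hN, Finset.sum_mul]
  refine (Finset.abs_sum_le_sum_abs _ _).trans (Finset.sum_le_sum fun p _ => ?_)
  exact abs_re_trace_skew_mul_le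
    (star_transportedSum_eq_neg (U ⟨p.src, p.μ⟩) (U ⟨p.src.shift p.μ, p.ν⟩) (U ⟨p.src.shift p.ν, p.μ⟩)
      (X ⟨p.src, p.μ⟩) (X ⟨p.src.shift p.μ, p.ν⟩) (X ⟨p.src.shift p.ν, p.μ⟩) (X ⟨p.src, p.ν⟩))
    (norm_transportedSum_le (U ⟨p.src, p.μ⟩) (U ⟨p.src.shift p.μ, p.ν⟩) (U ⟨p.src.shift p.ν, p.μ⟩)
      (X ⟨p.src, p.μ⟩) (X ⟨p.src.shift p.μ, p.ν⟩) (X ⟨p.src.shift p.ν, p.μ⟩) (X ⟨p.src, p.ν⟩))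
    (hδ p)

/-- **UNIFORM FORM**: if every plaquette variable of the background is within `δ` of `1` (`‖U(∂p) − 1‖ ≤ δ`, operator norm), then for every direction `X : bonds → 𝔰𝔲(N)`
`|d∕ds A(U·e^{sX})∣₀| ≤ δ·Σ_p (‖X_{b₁}‖ + ‖X_{b₂}‖ + ‖X_{b₃}‖ + ‖X_{b₄}‖)`. [cite: Balaban1989LargeFieldII, (1.12) p.359, p.357; Balaban1985BackgroundPropagators, (3.7) p.391] -/
theorem abs_deriv_wilsonAction4_expChart_zero_le (U : GaugeField P j (SU N)) (X : PBond P j → lieSU (Fin N)) {δ : ℝ}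
    (hδ : ∀ p : Plaq P j, ‖((GaugeField.plaqHol U p : SU N) : Matrix (Fin N) (Fin N) ℂ) - 1‖ ≤ δ) :
    |deriv (fun s : ℝ => wilsonAction4 (expChart U (s • X))) 0|
      ≤ δ * ∑ p : Plaq P j, (‖(X ⟨p.src, p.μ⟩ : Matrix (Fin N) (Fin N) ℂ)‖ + ‖(X ⟨p.src.shift p.μ, p.ν⟩ : Matrix (Fin N) (Fin N) ℂ)‖
        + ‖(X ⟨p.src.shift p.ν, p.μ⟩ : Matrix (Fin N) (Fin N) ℂ)‖ + ‖(X ⟨p.src, p.ν⟩ : Matrix (Fin N) (Fin N) ℂ)‖) := by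
  rw [Finset.mul_sum]
  exact abs_deriv_wilsonAction4_expChart_zero_le_local U X (fun _ => δ) hδ

/-- ★ **`ℓ¹(bonds)` FORM**: with a uniform curvature budget `‖U(∂p) − 1‖ ≤ δ`, `|d∕ds A(U·e^{sX})∣₀| ≤ 2(d−1)·δ·Σ_b ‖X_b‖` — each positively oriented bond lies on exactly
`2(d−1)` positively oriented plaquettes (dag-n12-w2 g2's `sum_plaq_boundary_eq`, p593907); the current as a functional on `ℓ¹(bonds)` has norm `≤ 2(d−1)δ`.
[cite: Balaban1989LargeFieldII, (1.12) p.359, p.357; Balaban1985Variational, (2) p.278; Balaban1985BackgroundPropagators, (3.7) p.391] -/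
theorem abs_deriv_wilsonAction4_expChart_zero_le_l1 (U : GaugeField P j (SU N)) (X : PBond P j → lieSU (Fin N)) {δ : ℝ}
    (hδ : ∀ p : Plaq P j, ‖((GaugeField.plaqHol U p : SU N) : Matrix (Fin N) (Fin N) ℂ) - 1‖ ≤ δ) :
    |deriv (fun s : ℝ => wilsonAction4 (expChart U (s • X))) 0|
      ≤ 2 * ((P.d : ℝ) - 1) * δ * ∑ b : PBond P j, ‖(X b : Matrix (Fin N) (Fin N) ℂ)‖ := by
  have h := abs_deriv_wilsonAction4_expChart_zero_le U X hδ
  rw [sum_plaq_boundary_eq (fun b : PBond P j => ‖(X b : Matrix (Fin N) (Fin N) ℂ)‖)] at h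
  calc |deriv (fun s : ℝ => wilsonAction4 (expChart U (s • X))) 0|
      ≤ δ * (2 * ((P.d : ℝ) - 1) * ∑ b : PBond P j, ‖(X b : Matrix (Fin N) (Fin N) ℂ)‖) := h
    _ = 2 * ((P.d : ℝ) - 1) * δ * ∑ b : PBond P j, ‖(X b : Matrix (Fin N) (Fin N) ℂ)‖ := by ring

/-- **FLAT CURVATURE ⇒ CRITICAL**: if every plaquette variable of `U` is `1` (`U ≡ 1`, or any pure gauge), the first variation of (5) at `U` vanishes in every direction —
every flat-curvature configuration is a critical point of the Wilson action (the absolute minimum `A = 0`).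
[cite: Balaban1985Variational, (5) p.278, Sect. F p.300; Balaban1985BackgroundPropagators, (3.7) p.391] -/
theorem deriv_wilsonAction4_expChart_zero_eq_zero_of_plaqHol_eq_one (U : GaugeField P j (SU N)) (X : PBond P j → lieSU (Fin N))
    (hU : ∀ p : Plaq P j, GaugeField.plaqHol U p = 1) :
    deriv (fun s : ℝ => wilsonAction4 (expChart U (s • X))) 0 = 0 := by
  have h := abs_deriv_wilsonAction4_expChart_zero_le_local U X (fun _ => 0) fun p => by
    have hW : ((GaugeField.plaqHol U p : SU N) : Matrix (Fin N) (Fin N) ℂ) = 1 := by rw [hU p]; rfl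
    rw [hW, sub_self, norm_zero]
  simp only [zero_mul, Finset.sum_const_zero] at h
  exact abs_eq_zero.mp (le_antisymm h (abs_nonneg _))

end Lattice

end Literature.MathematicalPhysics.QuantumFieldTheory.Balaban1983to89.Node00

end
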